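import Summits.QuantumFields.YangMills.Theorems.BalabanUVNodesN08AlphaEq324RowCore

/-!
# Route «BalabanUVNodes», Track-A DAG node N08 = [Balaban1985UV3] Thm 1 p. 257 ∕ Thm 2 p. 272 — THE CENSUS OBJECT IN THE SOURCE-FAITHFUL CORE CURRENCY:
# dag-n08-d's DATA schema `StepDataRows` (21 displayed rows per step) re-typed as `StepDataRowsEq324Core` (15 rows: the [B1] (3.24) input AS PRINTED, no
# Gaussian-regularity rows), the definitional split `StepAlphaEq324Core ↔ data schema ∧ class-I rows`, and the lane's END theorem from «core DATA schema ∧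
# in-edge faces»

Cell `pub-ymgap`, seat `pub-ymgap-dag-n08-w4` gen 0 (INTENT-4; sequel of `…N08AlphaEq324RowCore` p588551 ✓ and of gen 0's `…N08AlphaClassI(Discharge)`).
`bears_on: R4∕N08`; filed `--supports stmt-QuantumFields-20542` (K1⁷).  Two `Prop`-structures + theorems; sorry-free; standard axioms; the lane and
dag-n08-d's files consumed BY NAME.

WHY.  The N08 census at the (α) granularity (`HOME/pub-ymgap-dag-n08-b/N08-ALPHA-ROWS.md` §2; dag-lead NODE-TABLE row n08 «ESTIMATE ASSUMED AS ADMISSIBILITY»)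
reads dag-n08-d's `RunDataRows` = per step the 21-row `StepDataRows k` + the (43)-form `OldTermForm 𝔏 k`.  After the source-faithful edition (`…N08AlphaEq324Row`:
(3.24) as ONE printed `Eq324` row) and the idle-row certificate (`…N08AlphaEq324RowCore`: the five Gaussian-regularity rows serve nothing else), the displayed
DATA of a step shrinks to 15 rows.  This file types that census object and shows it carries the clause and the END theorem exactly as gen 0's schema does:
* §1 `StepDataRowsEq324Core k` (15 rows: G3D-01∕02∕04∕05∕06, (26), (28), `hPY`∕`hPYZ`∕`hact`, the PRINTED (3.24) row `h324`, `Pint` measurable + bounded,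
  the residual pair R3D-01∕02) · `RunDataRowsEq324Core` (+ `OldTermForm 𝔏 k` verbatim).
* §2 `stepAlphaEq324Core_iff` (`StepAlphaEq324Core k ↔ StepDataRowsEq324Core k ∧ StepRowsI k`, definitional repackaging as gen 0's `stepAlpha_iff`) ·
  `runAlphaEq324Core_iff` · `stepDataRowsEq324Core_of_stepDataRows` ∕ `runDataRowsEq324Core_of_runDataRows` (gen 0's schema IMPLIES the core schema:
  `stepAlphaEq324_of_stepAlpha`'s (3.24) step + dropping rows).
* §3 `runAlphaEq324Core_of_dataCore_faces` (core schema ∧ `InEdgeFaces` ⇒ core clause, via gen 0's `runRowsI_of_faces`) · ★ `uvStability3D_of_dataCore_faces`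
  (the lane's END theorem from «core DATA schema ∧ in-edge faces» for every group as printed — gen 0's `uvStability3D_of_data_faces` in the core currency).
HONEST SCOPE ∕ A6.  Schema bookkeeping; the core schema is IMPLIED by gen 0's (§2), so it inherits its inhabitants (zero data: `…RowCoreZero.stepAlphaEq324Core_zero_iff`
with `…ZeroDataRows.stepRowsI_zero_iff`); nothing of [B10] decided (the 15 rows ARE the cluster expansion = N08's object gap, class II); not a defect of any landed
module.  Count-neutral; N08 NOT discharged; one finite 𝕋⁴ programme at fixed ε, d = 3 tori of [B10] inside the record, Bałaban AS PRINTED; nothing about d = 4,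
the continuum, OS axioms, a mass gap or Clay — R4 closes the conditional finite-𝕋⁴ rung `BalabanLadder.UV` only.
-/

noncomputable section

namespace Summit.QuantumFields.YangMills.Theorems.BalabanUVNodesN08AlphaEq324RowSchema

open MeasureTheory Metric
open scoped BigOperators Nat Matrix.Norms.L2Operator
open Literature.MathematicalPhysics.QuantumFieldTheory.Balaban1983to89
open Literature.MathematicalPhysics.QuantumFieldTheory.Balaban1983to89.B10
open Literature.MathematicalPhysics.QuantumFieldTheory.Balaban1983to89.B10SectCExpansion (Shape43 Bound44 TermSizes)
open Literature.MathematicalPhysics.QuantumFieldTheory.Balaban1983to89.TreeLengthTorus (tsys tcubeSys)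
open Literature.MathematicalPhysics.QuantumFieldTheory.Balaban1983to89.B1Sect3Statements (Eq324)
open Literature.MathematicalPhysics.QuantumFieldTheory.Balaban1985CMP102
open Literature.MathematicalPhysics.QuantumFieldTheory.Balaban1985CMP102.Setting
open Literature.MathematicalPhysics.QuantumFieldTheory.Balaban1985CMP102.Theorems
open Literature.MathematicalPhysics.QuantumFieldTheory.Balaban1985CMP102.Binders
  (ChartAnalyticityAsCited FarTermsDecayAsCited Norm35StepAsCited LogZTExtensiveAsCited LogZLocalizedAsCited GraphTerms GraphRep23AsCited)
open Literature.MathematicalPhysics.QuantumFieldTheory.Balaban1985CMP102.BindersNewborn (NewbornTerms45AsCited)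
open Summit.QuantumFields.Balaban3D.Carriers
open Summit.QuantumFields.Balaban3D.Proofs
open Summit.QuantumFields.Balaban3D.Proofs.ScalesArithmetic
open Summit.QuantumFields.Balaban3D.Proofs.Constants
open Summit.QuantumFields.Balaban3D.Proofs.UVStability3D
open Summit.QuantumFields.Balaban3D.Proofs.EndTheorem
open Summit.QuantumFields.Balaban3D.Proofs.Inputs
open Summit.QuantumFields.Balaban3D.Proofs.Residuals
open Summit.QuantumFields.Balaban3D.Proofs.Primitives
open Summit.QuantumFields.Balaban3D.Proofs.Representation33 (jet26)
open Summit.QuantumFields.Balaban3D.Proofs.Bound55Std (Fibre49 Fibre57Low)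
open Summit.QuantumFields.Balaban3D.Proofs.GroupModelLieC (lieC)
open Summit.QuantumFields.Balaban3D.Proofs.UVStability3DInputs
open Summit.QuantumFields.YangMills.Theorems.BalabanUVNodesN08AlphaClassI
open Summit.QuantumFields.YangMills.Theorems.BalabanUVNodesN08AlphaClassIDischarge (runRowsI_of_faces)
open Summit.QuantumFields.YangMills.Theorems.BalabanUVNodesN08AlphaEq324Row
open Summit.QuantumFields.YangMills.Theorems.BalabanUVNodesN08AlphaEq324RowCore

variable {L : ℕ}

/-! ## §1 The DATA schema of a step in the source-faithful CORE currency -/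

section Schema

variable {S : Scales L} {G : Type} [GaugeGroup G] [MeasurableSpace G] [HaarData G] (𝔊 : GroupModel G) (𝔠 : AlphaConsts L 𝔊.N)
  (X : ExternalInputs S G) (𝔖 : ∀ k, StepSeries S G ↥(lieC 𝔊) (nblkOf S 𝔠.lane.carrier k) k) (𝔄 : AlphaData 𝔊 𝔠 X 𝔖)
  (𝔏 : OldTermSizes S G)

open Classical in
/-- **THE CLUSTER-EXPANSION DATA OF STEP `k → k+1`, DISPLAYED, CORE CURRENCY** — gen 0's `…N08AlphaClassI.StepDataRows k` with the [B1] (3.24) input as the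
ONE printed row `h324` (instead of `h324a`∕`h324c`) and WITHOUT the five Gaussian-regularity rows `hμ hboxm hbox hVm hVB`: fifteen rows — the GAP binders
G3D-01∕02∕04∕05∕06 «as cited», the displays (26), (28), the identifications R-ACT ∕ batch 11 (a), the printed (3.24) sentence, `Pint` measurable and bounded,
and the residual rows R3D-01∕02.  HYPOTHESES; nothing asserted. [cite: Balaban1985UV3, (23)–(33) pp.262–264 + (55)–(63) pp.269–272; Balaban1982Higgs1, (3.24) p.616] -/
structure StepDataRowsEq324Core (k : ℕ) : Prop where
  /-- G3D-01 at the (25)-rate (R-ACT) -/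
  chart : ∀ Y, ChartAnalyticityAsCited ((𝔖 k).Ψ Y) 𝔠.ρ
    (𝔠.C25 * S.gk k * Real.exp (-(𝔠.κ * (tsys 3 (nblkOf S 𝔠.lane.carrier k)).dj Y)))
  /-- (28) p. 263 -/
  bound28 : ∀ Y h U, ‖(𝔖 k).Bcfg Y h U‖ ≤ 𝔠.cB * (rFun 𝔠.r₀ (S.gk k) * S.gk k * pFun 𝔠.b₀ 𝔠.p₀ (S.gk k))
  /-- (26) in the chart space, for the adjoint action -/
  inv26 : ∀ Y (U : G), ∀ b ∈ ball (0 : (𝔖 k).E) 𝔠.ρ, adjAct 𝔊 (P := S.P) k U b ∈ ball (0 : (𝔖 k).E) 𝔠.ρ →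
    (𝔖 k).Ψ Y (adjAct 𝔊 (P := S.P) k U b) = (𝔖 k).Ψ Y b
  /-- G3D-06 -/
  far_le : FarTermsDecayAsCited (𝔖 k).far
    (fun Y => 𝔠.C25 * S.gk k * Real.exp (-(𝔠.κ * (tsys 3 (nblkOf S 𝔠.lane.carrier k)).dj Y)))
    𝔠.Cfar (S.gk k ^ 7 * (rFun 𝔠.r₀ (S.gk k) * pFun 𝔠.b₀ 𝔠.p₀ (S.gk k)) ^ 7)
  /-- identification of `PY` with the retained jet (batch 11 (a)) -/
  hPY : ∀ h U, (𝔖 k).PY h U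
    = ∑ Y ∈ (𝔖 k).loc (ΩblkOf 𝔠.lane.carrier.M₁ (rcolOf S 𝔠.lane.carrier) (nblkOf S 𝔠.lane.carrier k)) (rretOf S 𝔠.lane.carrier k) h,
        ((jet26 ((𝔖 k).Ψ Y) ((𝔖 k).Bcfg Y h U)).re - (𝔖 k).far Y h U)
  /-- identification of `PYZ` with the retained jet of the G3D-07 pieces -/
  hPYZ : ∀ h U, (𝔖 k).PYZ h U
    = ∑ Y ∈ (𝔖 k).loc (ΩblkOf 𝔠.lane.carrier.M₁ (rcolOf S 𝔠.lane.carrier) (nblkOf S 𝔠.lane.carrier k)) (rretOf S 𝔠.lane.carrier k) h,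
        ((jet26 ((𝔄.Λc k).Ψ Y) ((𝔖 k).Bcfg Y h U)).re - (𝔄.Λc k).far Y h U)
  /-- G3D-04 -/
  norm35 : Norm35StepAsCited (pieces 𝔠.lane X 𝔖 k) 𝔠.c35 𝔠.a35 𝔠.cv 𝔠.cJ35
  /-- G3D-05 -/
  logZT : LogZTExtensiveAsCited (pieces 𝔠.lane X 𝔖 k) 𝔠.cT 𝔠.aT 𝔠.cn 𝔠.cJT
  /-- R-ACT: the graph carrier's activities are the chart activities -/
  hact : ∀ h Y U, ((𝔖 k).Gt h).activities.act Y U = (𝔖 k).act h Y U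
  /-- G3D-02 -/
  hG : ∀ h, GraphRep23AsCited ((𝔖 k).Gt h) (fun U => ∑ n ∈ Finset.Icc 1 𝔠.nbar, (𝔖 k).cum h U n / (n.factorial : ℝ))
    (𝔄.C₂₃ k) (𝔄.c₂₃ k) (𝔄.M₂₃ k) (𝔄.δ₀ k)
  /-- [B1] (3.24) AS PRINTED for the step's fluctuation integral over the small-field box -/
  h324 : ∀ h (U : GaugeField S.P (k + 1) G),
    Eq324 (∫ ω in (𝔖 k).box h, Real.exp ((𝔖 k).𝒱 h U ω) ∂(𝔖 k).μ) ((𝔖 k).cum h U) 𝔠.nbar (𝔠.Ca + 𝔠.Cc)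
      ((L : ℝ) ^ k * S.g0sq) (3 + 𝔠.κ₀) (S.sites k)
  /-- data regularity: the interaction sum `Pint k h` of (43) is measurable in `U` … -/
  hPm : ∀ h : Hist S.P k, Measurable ((inputOf 𝔠.lane X 𝔖).Pint k h)
  /-- … and bounded above -/
  hPb : ∀ (h : Hist S.P k) (U : GaugeField S.P k G), (inputOf 𝔠.lane X 𝔖).Pint k h U ≤ 𝔄.cP k
  /-- RESIDUAL R3D-01 (p4) -/
  fibre49 : ∀ h' : Hist S.P (k + 1), Fibre49 X 𝔠.lane.carrier 𝔖 (fun _ => True) k (piecesW 𝔠.lane X 𝔖 k) h'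
  /-- RESIDUAL R3D-02 (p4) -/
  fibre57Low : Fibre57Low X 𝔠.lane.carrier 𝔖 (fun _ => True) k (piecesW 𝔠.lane X 𝔖 k)

/-- **THE CLUSTER-EXPANSION DATA OF ONE LATTICE APPROXIMATION, CORE CURRENCY**: per step `k < K` the core data schema and gen 0's (43)-form `OldTermForm 𝔏 k`
verbatim.  The N08 «ESTIMATE ASSUMED AS ADMISSIBILITY» list at the (α) granularity, in the printed (3.24) currency. [cite: Balaban1985UV3, (41) p.266 + (47) p.267 + (43) p.266] -/
structure RunDataRowsEq324Core : Prop where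
  /-- the core data schema per step -/
  steps : ∀ k, k + 1 ≤ S.K → StepDataRowsEq324Core 𝔊 𝔠 X 𝔖 𝔄 k
  /-- (43) per step -/
  form43 : ∀ k, k + 1 ≤ S.K → OldTermForm 𝔊 𝔠 𝔖 𝔏 k

/-! ## §2 The definitional split of the core clause; gen 0's schema implies the core schema -/

/-- **THE SPLIT OF A CORE STEP**: `StepAlphaEq324Core k` IS «core data schema ∧ class-I rows» (definitional repackaging, as gen 0's `stepAlpha_iff`).
[cite: Balaban1985UV3, (41) p.266 (bookkeeping)] -/
theorem stepAlphaEq324Core_iff (k : ℕ) :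
    StepAlphaEq324Core 𝔊 𝔠 X 𝔖 𝔄 k ↔ StepDataRowsEq324Core 𝔊 𝔠 X 𝔖 𝔄 k ∧ StepRowsI 𝔊 𝔠 X 𝔖 k := by
  constructor
  · intro A
    exact ⟨⟨A.chart, A.bound28, A.inv26, A.far_le, A.hPY, A.hPYZ, A.norm35, A.logZT, A.hact, A.hG, A.h324, A.hPm, A.hPb,
        A.fibre49, A.fibre57Low⟩, ⟨A.hU, A.h44, A.hfloor⟩⟩
  · rintro ⟨D, I⟩
    exact ⟨D.chart, D.bound28, D.inv26, D.far_le, D.hPY, D.hPYZ, D.norm35, D.logZT, D.hact, D.hG, D.h324, I.h44, I.hfloor, I.hU,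
      D.hPm, D.hPb, D.fibre49, D.fibre57Low⟩

/-- **THE SPLIT OF THE CORE RUN**: `RunAlphaEq324Core` IS «(∀ k < K, core data schema) ∧ class-I rows». [cite: Balaban1985UV3, (41) p.266 (bookkeeping)] -/
theorem runAlphaEq324Core_iff :
    RunAlphaEq324Core 𝔊 𝔠 X 𝔖 𝔄 ↔ (∀ k, k + 1 ≤ S.K → StepDataRowsEq324Core 𝔊 𝔠 X 𝔖 𝔄 k) ∧ RunRowsI 𝔊 𝔠 X 𝔖 := by
  constructor
  · intro R
    exact ⟨fun k hk => ((stepAlphaEq324Core_iff 𝔊 𝔠 X 𝔖 𝔄 k).1 (R.steps k hk)).1,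
      ⟨fun k hk => ((stepAlphaEq324Core_iff 𝔊 𝔠 X 𝔖 𝔄 k).1 (R.steps k hk)).2, R.hLF67, R.h68⟩⟩
  · rintro ⟨D, I⟩
    exact ⟨fun k hk => (stepAlphaEq324Core_iff 𝔊 𝔠 X 𝔖 𝔄 k).2 ⟨D k hk, I.steps k hk⟩, I.hLF67, I.h68⟩

variable {𝔊 𝔠 X 𝔖 𝔄 𝔏}

/-- **GEN 0's DATA SCHEMA IMPLIES THE CORE DATA SCHEMA** (the (3.24) rows (a)+(c) give the printed sandwich by the lane's `eq324_indicator_of_measurableSet` —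
the only place where `hμ hboxm hbox hVm hVB` are read —, every other row carried over).  No converse. [cite: Balaban1982Higgs1, (3.24) p.616; Balaban1985UV3, (58) p.270] -/
theorem stepDataRowsEq324Core_of_stepDataRows {k : ℕ} (D : StepDataRows 𝔊 𝔠 X 𝔖 𝔄 k) : StepDataRowsEq324Core 𝔊 𝔠 X 𝔖 𝔄 k where
  chart := D.chart
  bound28 := D.bound28
  inv26 := D.inv26
  far_le := D.far_le
  hPY := D.hPY
  hPYZ := D.hPYZ
  norm35 := D.norm35
  logZT := D.logZT
  hact := D.hact
  hG := D.hG
  h324 h U := by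
    haveI := D.hμ
    have h := eq324_indicator_of_measurableSet (C₂ := 0) (𝔖 k).μ (D.hboxm h) (D.hbox h) (D.hVm h U) (D.hVB h U)
      𝔠.nbar ((𝔖 k).cum h U) (D.h324a h U) (by simp [StepSeries.cum]) (D.h324c h U)
    simpa only [add_zero] using h
  hPm := D.hPm
  hPb := D.hPb
  fibre49 := D.fibre49
  fibre57Low := D.fibre57Low

/-- … and run by run (the (43)-form is carried over verbatim). [cite: Balaban1985UV3, (41) p.266 + (43) p.266 (bookkeeping)] -/
theorem runDataRowsEq324Core_of_runDataRows (D : RunDataRows 𝔊 𝔠 X 𝔖 𝔄 𝔏) : RunDataRowsEq324Core 𝔊 𝔠 X 𝔖 𝔄 𝔏 where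
  steps k hk := stepDataRowsEq324Core_of_stepDataRows (D.steps k hk)
  form43 := D.form43

/-! ## §3 The core clause and the END theorem from «core DATA schema ∧ in-edge faces» -/

/-- **THE CORE (α) CLAUSE FROM «CORE DATA SCHEMA ∧ IN-EDGE FACES»**: `RunAlphaEq324Core` from `RunDataRowsEq324Core` and gen 0's `InEdgeFaces` (the class-I
rows by gen 0's `runRowsI_of_faces` from the (43)-form + the faces). [cite: Balaban1985UV3, (43)–(44) pp.266–267 + (67)–(68) p.273] -/
theorem runAlphaEq324Core_of_dataCore_faces (D : RunDataRowsEq324Core 𝔊 𝔠 X 𝔖 𝔄 𝔏) (F : InEdgeFaces 𝔊 𝔠 X 𝔏) :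
    RunAlphaEq324Core 𝔊 𝔠 X 𝔖 𝔄 :=
  (runAlphaEq324Core_iff 𝔊 𝔠 X 𝔖 𝔄).2 ⟨D.steps, runRowsI_of_faces D.form43 F⟩

end Schema

section End

/-- ★ **THE LANE'S END THEOREM FROM «CORE DATA SCHEMA ∧ IN-EDGE FACES»** (gen 0's `uvStability3D_of_data_faces` in the source-faithful core currency): for every
group as printed, primitive constants, external inputs, expansion data, auxiliary data and (43)-sizes, IF on the exhibited family the 15-row core DATA schema
(+ (43)-form) and the in-edge faces hold, THEN `Thm1AsPrintedCompact ∧ Thm2AsPrintedC (laneT 𝔠 X 𝔖).toConstruction` — via `…RowCore.uvStability3D_of_inputsEq324Core`.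
MODULO the displayed inputs; nothing of print discharged. [cite: Balaban1985UV3, Thm 1 p.257 + Thm 2 p.272 + p.256 L15–18] -/
theorem uvStability3D_of_dataCore_faces
    (𝔠 : ∀ (G : Type) [GaugeGroup G] [MeasurableSpace G] [HaarData G] (𝔊 : GroupModel G), AlphaConsts L 𝔊.N)
    (X : ∀ (G : Type) [GaugeGroup G] [MeasurableSpace G] [HaarData G], GroupModel G → ∀ S : Scales L, ExternalInputs S G)
    (𝔖 : ∀ (G : Type) [GaugeGroup G] [MeasurableSpace G] [HaarData G] (𝔊 : GroupModel G) (S : Scales L) (k : ℕ),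
      StepSeries S G ↥(lieC 𝔊) (nblkOf S (𝔠 G 𝔊).lane.carrier k) k)
    (𝔄 : ∀ (G : Type) [GaugeGroup G] [MeasurableSpace G] [HaarData G] (𝔊 : GroupModel G) (S : Scales L),
      AlphaData 𝔊 (𝔠 G 𝔊) (X G 𝔊 S) (𝔖 G 𝔊 S))
    (𝔏 : ∀ (G : Type) [GaugeGroup G] [MeasurableSpace G] [HaarData G], GroupModel G → ∀ S : Scales L, OldTermSizes S G)
    (hD : ∀ (G : Type) [GaugeGroup G] [MeasurableSpace G] [HaarData G] (𝔊 : GroupModel G) (S : Scales L),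
      S.ε₀ = eps0Of (𝔠 G 𝔊).gamma0 S.g → RunDataRowsEq324Core 𝔊 (𝔠 G 𝔊) (X G 𝔊 S) (𝔖 G 𝔊 S) (𝔄 G 𝔊 S) (𝔏 G 𝔊 S))
    (hF : ∀ (G : Type) [GaugeGroup G] [MeasurableSpace G] [HaarData G] (𝔊 : GroupModel G) (S : Scales L),
      S.ε₀ = eps0Of (𝔠 G 𝔊).gamma0 S.g → InEdgeFaces 𝔊 (𝔠 G 𝔊) (X G 𝔊 S) (𝔏 G 𝔊 S)) :
    Thm1AsPrintedCompact (laneT 𝔠 X 𝔖).toConstruction ∧ Thm2AsPrintedC (laneT 𝔠 X 𝔖).toConstruction :=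
  uvStability3D_of_inputsEq324Core 𝔠 X 𝔖 𝔄 fun G _ _ _ 𝔊 S hS => runAlphaEq324Core_of_dataCore_faces (hD G 𝔊 S hS) (hF G 𝔊 S hS)

end End

end Summit.QuantumFields.YangMills.Theorems.BalabanUVNodesN08AlphaEq324RowSchema

end
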